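import Summits.SmoothPoincare4.SmoothPoincare4.Theorems.EntropyRungNoncompactShrinkerGapHeatCutoffToolkit
import Summits.SmoothPoincare4.SmoothPoincare4.Theorems.EntropyRungNoncompactShrinkerGapHeatFisherCutoff
import Literature.Geometry.Riemannian.WeightedGreenComplete
import Literature.Geometry.Riemannian.CompleteManifoldCutoff
import HarnessLib

/-!
# Gaffney cut-offs and the first-order integration-by-parts toolkit on a complete weighted
# manifold (support item `EntropyRung.BakryEmeryLogSobolev`, stmt-SmoothPoincare4-16587)

Setting: `M` modelled on `ℝⁿ` (Hausdorff, second countable, `T₃`, Borel — NOT compact), `g`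
Riemannian with its Levi-Civita connection, `V` smooth (NO further assumption on `V`),
`L = Δ_g − g⁻¹(dV, d·)`, weight `e^{-V} dV_g`. The cut-offs are GAFFNEY's: `η_k ∈ C_c^∞`,
`0 ≤ η_k ≤ 1`, `η_k → 1` pointwise and `|∇η_k|² ≤ C₀/(k+1)²` — available on every complete
Riemannian manifold (`exists_cutoff_of_isGeodesicallyComplete`), whereas the bounded-`Lη_k`
cut-offs of the shrinker toolkit (`EntropyRungNoncompactShrinkerGapHeat*.lean`) need curvature /
potential bounds that a general `CD(K, ∞)` weighted manifold does not have.

* `exists_gaffney_cutoff` — a MONOTONE exhausting family of Gaffney cut-offs on a connected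
  complete Riemannian manifold (scales `2^{k+1}` about a base point);
* `integral_mul_cutoffSq_mul_weightedLaplacian` — `∫ a η² (Lu) e^{-V} = −∫ η² g⁻¹(da, du) e^{-V}
  − 2 ∫ a η g⁻¹(dη, du) e^{-V}` (weighted Green identity with the compactly supported factor `a η²`);
* `neg_four_mul_cutoff_innerDual_le` — the pointwise first-order absorption
  `−4 (ρ − c) η g⁻¹(dη, dρ) ≤ η²|∇ρ|² + 4(ρ − c)²|∇η|²`.

The energy estimate itself is `EntropyRungBakryEmeryLogSobolevGaffneyEnergy.lean`. This is the
toolkit of the `L²` ("finite energy") route of Bakry–Gentil–Ledoux (2014), §3.2, pp. 141–147, where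
every integration by parts on the complete manifold is justified with cut-offs `ζ_k` having only
`Γ(ζ_k) ≤ 1/k`. Everything is proved; no definitions, no named facts.

## References

* [BakryGentilLedoux2014] D. Bakry, I. Gentil, M. Ledoux, *Analysis and Geometry of Markov
  Diffusion Operators*, Springer 2014, §3.2 (pp. 141–147), Prop. 3.2.1, Thm. 3.2.6 (proofs).
* [Gaffney1954] M. P. Gaffney, Ann. of Math. 60 (1954) 140–145 (cut-offs on complete manifolds).
* [CarrilloNi2009] J. A. Carrillo, L. Ni, Comm. Anal. Geom. 17 (2009), §4.
-/

noncomputable section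

set_option linter.dupNamespace false

open scoped Manifold ContDiff ENNReal NNReal Topology
open MeasureTheory Set Filter
open Literature.Geometry.Lorentzian Literature.Geometry.Riemannian

namespace Summit.SmoothPoincare4.SmoothPoincare4.Theorems.BakryEmeryComplete

open NoncompactShrinkerGapHeat NoncompactShrinkerGapHeat.CutoffToolkit

/-! ### Monotone Gaffney cut-offs on a connected complete Riemannian manifold -/

section Gaffney

variable {n : ℕ} {M : Type} [TopologicalSpace M] [T2Space M] [SecondCountableTopology M]
  [ChartedSpace (EuclideanSpace ℝ (Fin n)) M] [IsManifold (𝓡 n) ∞ M] [ConnectedSpace M]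
  {g : PseudoRiemannianMetric (𝓡 n) ∞ (EuclideanSpace ℝ (Fin n)) (TangentSpace (𝓡 n) : M → Type _)}
  [g.HasLeviCivita]

/-- **Monotone Gaffney cut-offs.** On a connected complete Riemannian manifold modelled on `ℝⁿ`
(closed `g.edist`-balls compact) there are `η_k ∈ C_c^∞(M; [0,1])`, `k ∈ ℕ`, with
`η_k ≤ η_{k+1}`, `η_k(x) = 1` for all large `k` (every `x`), and `|∇η_k|²_g ≤ C₀/(k+1)²`: the
cut-offs of `exists_cutoff_of_isGeodesicallyComplete` (Gaffney 1954; Carron) about a base point at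
the scales `2^{k+1}` — `η_k = 1` on `B(o, 2^k)`, `tsupport η_k ⊆ B(o, 2^{k+1})` where `η_{k+1} = 1`.
[cite: Gaffney1954] [cite: BakryGentilLedoux2014, §3.2 (p. 142, the sequence ζ_k)] -/
theorem exists_gaffney_cutoff (hg : g.IsRiemannian)
    (hc : ∀ (x : M) (r : NNReal), IsCompact {y : M | g.edist hg x y ≤ r}) :
    ∃ (η : ℕ → M → ℝ) (C₀ : ℝ), (∀ k, ContMDiff (𝓡 n) 𝓘(ℝ, ℝ) ∞ (η k)) ∧
      (∀ k, HasCompactSupport (η k)) ∧ (∀ k x, 0 ≤ η k x ∧ η k x ≤ 1) ∧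
      (∀ k x, η k x ≤ η (k + 1) x) ∧ (∀ x, ∀ᶠ k in atTop, η k x = 1) ∧
      ∀ k x, g.gradSq (η k) x ≤ C₀ / ((k : ℝ) + 1) ^ 2 := by
  haveI : Nonempty M := ConnectedSpace.toNonempty
  obtain ⟨o⟩ := ‹Nonempty M›
  have hk1 : ((1 : ℕ∞) : ℕ∞ω) + 1 ≤ (∞ : ℕ∞ω) := by
    rw [show ((1 : ℕ∞) : ℕ∞ω) + 1 = 2 by norm_num]; exact WithTop.coe_le_coe.2 le_top
  haveI : CovariantDerivative.ContMDiffCovariantDerivative g.leviCivita 1 :=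
    ⟨g.isLocallyContMDiff_leviCivita_holds 1 hk1 univ isOpen_univ⟩
  have hgc : IsGeodesicallyComplete g.leviCivita :=
    (isGeodesicallyComplete_iff_isCompact_setOf_edist_le g le_rfl hg).2 hc
  obtain ⟨C₀, hC₀'⟩ := exists_cutoff_of_isGeodesicallyComplete.{0, 0, 0}
  have h := fun k : ℕ ↦ hC₀' (𝓡 n) M g hg hgc o ((2 : ℝ) ^ (k + 1)) (by positivity)
  choose η hηs hηc hη0 hη1 hηone hηsupp hηgrad using h
  have hC₀ : 0 ≤ C₀ := by
    have h1 := hηgrad 0 o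
    have h2 : 0 ≤ g.gradSq (η 0) o := g.gradSq_nonneg hg _ _
    have h3 : (0 : ℝ) < ((2 : ℝ) ^ (0 + 1)) ^ 2 := by positivity
    rcases div_nonneg_iff.1 (h2.trans h1) with h | h
    · exact h.1
    · exact absurd h.2 (not_le.mpr h3)
  refine ⟨η, C₀, hηs, hηc, fun k x ↦ ⟨hη0 k x, hη1 k x⟩, fun k x ↦ ?_, fun x ↦ ?_, fun k x ↦ ?_⟩
  · -- monotonicity: off `tsupport η_k`, `η_k = 0 ≤ η_{k+1}`; on it, `d(o,x) < 2^{k+1}` so `η_{k+1} = 1`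
    by_cases hx : x ∈ tsupport (η k)
    · have hd : g.edist hg o x < ENNReal.ofReal ((2 : ℝ) ^ (k + 1 + 1) / 2) := by
        have h1 := hηsupp k hx
        simp only [mem_setOf_eq] at h1
        convert h1 using 2
        rw [pow_succ]; ring
      rw [hηone (k + 1) x hd]
      exact hη1 k x
    · rw [image_eq_zero_of_notMem_tsupport hx]
      exact hη0 (k + 1) x
  · -- `d(o, x) < ∞`, hence `< 2^{k+1}/2 = 2^k` for all large `k`
    have hfin : g.edist hg o x ≠ ⊤ := (PseudoRiemannianMetric.edist_lt_top hg o x).ne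
    set d : ℝ := (g.edist hg o x).toReal with hd
    obtain ⟨N, hN⟩ : ∃ N : ℕ, d < 2 ^ N := by
      obtain ⟨N, hN⟩ := pow_unbounded_of_one_lt d (by norm_num : (1 : ℝ) < 2)
      exact ⟨N, hN⟩
    refine eventually_atTop.2 ⟨N, fun k hk ↦ hηone k x ?_⟩
    rw [← ENNReal.ofReal_toReal hfin]
    refine (ENNReal.ofReal_lt_ofReal_iff (by positivity)).2 ?_
    have h2 : (2 : ℝ) ^ N ≤ 2 ^ k := pow_le_pow_right₀ (by norm_num) hk
    rw [← hd, pow_succ]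
    linarith
  · -- `C₀ / (2^{k+1})² ≤ C₀ / (k+1)²`
    refine (hηgrad k x).trans ?_
    have h1 : ((k : ℝ) + 1) ≤ (2 : ℝ) ^ (k + 1) := by
      have h := Nat.lt_two_pow_self (n := k + 1)
      have h' : ((k + 1 : ℕ) : ℝ) < ((2 ^ (k + 1) : ℕ) : ℝ) := by exact_mod_cast h
      push_cast at h'
      linarith
    have h2 : ((k : ℝ) + 1) ^ 2 ≤ ((2 : ℝ) ^ (k + 1)) ^ 2 :=
      pow_le_pow_left₀ (by positivity) h1 2
    exact div_le_div_of_nonneg_left hC₀ (by positivity) h2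

end Gaffney

/-- A cut-off family which is eventually `1` at every point tends to `1` pointwise. [folklore] -/
theorem tendsto_cutoff_of_eventually_eq {X : Type*} {η : ℕ → X → ℝ}
    (hη1 : ∀ x, ∀ᶠ k in atTop, η k x = 1) (x : X) : Tendsto (fun k ↦ η k x) atTop (𝓝 1) :=
  tendsto_const_nhds.congr' ((hη1 x).mono fun _ hk ↦ hk.symm)

section Energy

variable {n : ℕ} {M : Type*} [TopologicalSpace M] [T2Space M] [SecondCountableTopology M]
  [ChartedSpace (EuclideanSpace ℝ (Fin n)) M] [IsManifold (𝓡 n) ∞ M] [T3Space M]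
  [MeasurableSpace M] [BorelSpace M]
  {g : PseudoRiemannianMetric (𝓡 n) ∞ (EuclideanSpace ℝ (Fin n)) (TangentSpace (𝓡 n) : M → Type _)}
  [g.HasLeviCivita]

/-! ### The weighted Green identity against `a η²` -/

/-- **`∫ a η² (Lu) e^{-V} = −∫ η² g⁻¹(da, du) e^{-V} − 2∫ a η g⁻¹(dη, du) e^{-V}`** for `a, u, V`
smooth and `η ∈ C_c^∞` (`weightedGreen_left` with the compactly supported factor `a η²`,
`d(a η²) = η² da + 2 a η dη`). [cite: BakryGentilLedoux2014, §3.2 (p. 141)] -/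
theorem integral_mul_cutoffSq_mul_weightedLaplacian (hg : g.IsRiemannian) {a u η V : M → ℝ}
    (ha : ContMDiff (𝓡 n) 𝓘(ℝ, ℝ) ∞ a) (hu : ContMDiff (𝓡 n) 𝓘(ℝ, ℝ) ∞ u)
    (hη : ContMDiff (𝓡 n) 𝓘(ℝ, ℝ) ∞ η) (hηc : HasCompactSupport η)
    (hV : ContMDiff (𝓡 n) 𝓘(ℝ, ℝ) ∞ V) :
    ∫ x, a x * η x ^ 2 * (g.dalembertian u x
        - g.innerDual x (mvfderiv (𝓡 n) V x).toLinearMap (mvfderiv (𝓡 n) u x).toLinearMap) *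
        Real.exp (-V x) ∂g.riemVolume =
      -(∫ x, η x ^ 2 * g.innerDual x (mvfderiv (𝓡 n) a x).toLinearMap
          (mvfderiv (𝓡 n) u x).toLinearMap * Real.exp (-V x) ∂g.riemVolume)
      - 2 * ∫ x, a x * η x * g.innerDual x (mvfderiv (𝓡 n) η x).toLinearMap
          (mvfderiv (𝓡 n) u x).toLinearMap * Real.exp (-V x) ∂g.riemVolume := by
  have h1 : (1 : ℕ∞ω) ≤ (∞ : ℕ∞ω) := WithTop.coe_le_coe.mpr le_top
  have h2 : (2 : ℕ∞ω) ≤ (∞ : ℕ∞ω) := WithTop.coe_le_coe.mpr le_top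
  -- the compactly supported factor `A = a η²`
  have hA : ContMDiff (𝓡 n) 𝓘(ℝ, ℝ) ∞ (fun x ↦ a x * (η x * η x)) := ha.mul (hη.mul hη)
  have hAc : HasCompactSupport (fun x ↦ a x * (η x * η x)) := (hηc.mul_left).mul_left
  have hG := weightedGreen_left hg (hA.of_le h1) hAc (hu.of_le h2) (hV.of_le h1)
  -- pointwise expansion of `g⁻¹(d(a η²), du)`
  have had : ∀ x, MDifferentiableAt (𝓡 n) 𝓘(ℝ, ℝ) a x := fun x ↦ ha.mdifferentiableAt (by simp)
  have hηd : ∀ x, MDifferentiableAt (𝓡 n) 𝓘(ℝ, ℝ) η x := fun x ↦ hη.mdifferentiableAt (by simp)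
  have hηηd : ∀ x, MDifferentiableAt (𝓡 n) 𝓘(ℝ, ℝ) (fun y ↦ η y * η y) x := fun x ↦
    (hηd x).mul (hηd x)
  have hpt : ∀ x, g.innerDual x (mvfderiv (𝓡 n) (fun y ↦ a y * (η y * η y)) x).toLinearMap
        (mvfderiv (𝓡 n) u x).toLinearMap =
      η x ^ 2 * g.innerDual x (mvfderiv (𝓡 n) a x).toLinearMap (mvfderiv (𝓡 n) u x).toLinearMap
        + 2 * (a x * η x * g.innerDual x (mvfderiv (𝓡 n) η x).toLinearMap
            (mvfderiv (𝓡 n) u x).toLinearMap) := by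
    intro x
    rw [innerDual_mvfderiv_mul_left (had x) (hηηd x), innerDual_mvfderiv_mul_left (hηd x) (hηd x)]
    ring
  -- continuity and integrability
  have hu1 : ContMDiff (𝓡 n) 𝓘(ℝ, ℝ) 1 u := hu.of_le h1
  have hec : Continuous fun x ↦ Real.exp (-V x) := Real.continuous_exp.comp hV.continuous.neg
  have hIau : Continuous fun x ↦ g.innerDual x (mvfderiv (𝓡 n) a x).toLinearMap
      (mvfderiv (𝓡 n) u x).toLinearMap := continuous_innerDual_mvfderiv g (ha.of_le h1) hu1
  have hIηu : Continuous fun x ↦ g.innerDual x (mvfderiv (𝓡 n) η x).toLinearMap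
      (mvfderiv (𝓡 n) u x).toLinearMap := continuous_innerDual_mvfderiv g (hη.of_le h1) hu1
  have hηz : ∀ x ∉ tsupport η, g.innerDual x (mvfderiv (𝓡 n) η x).toLinearMap
      (mvfderiv (𝓡 n) u x).toLinearMap = 0 := fun x hx ↦
    innerDual_mvfderiv_eq_zero_of_notMem_tsupport_left hx
  have hη2c : HasCompactSupport (fun x ↦ η x ^ 2) := by
    rw [show (fun x ↦ η x ^ 2) = fun x ↦ η x * η x from funext fun x ↦ sq (η x)]
    exact hηc.mul_right
  have i1 : Integrable (fun x ↦ η x ^ 2 * g.innerDual x (mvfderiv (𝓡 n) a x).toLinearMap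
      (mvfderiv (𝓡 n) u x).toLinearMap * Real.exp (-V x)) g.riemVolume := by
    refine integrable_of_continuous_of_hasCompactSupport' hg
      (((hη.continuous.pow 2).mul hIau).mul hec) ?_
    exact (hη2c.mul_right).mul_right
  have i2 : Integrable (fun x ↦ 2 * (a x * η x * g.innerDual x (mvfderiv (𝓡 n) η x).toLinearMap
      (mvfderiv (𝓡 n) u x).toLinearMap) * Real.exp (-V x)) g.riemVolume := by
    refine integrable_of_continuous_of_hasCompactSupport' hg
      ((continuous_const.mul ((ha.continuous.mul hη.continuous).mul hIηu)).mul hec) ?_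
    exact (((hηc.mul_left).mul_right).mul_left).mul_right
  have s1 : ∫ x, g.innerDual x (mvfderiv (𝓡 n) (fun y ↦ a y * (η y * η y)) x).toLinearMap
        (mvfderiv (𝓡 n) u x).toLinearMap * Real.exp (-V x) ∂g.riemVolume =
      ∫ x, (η x ^ 2 * g.innerDual x (mvfderiv (𝓡 n) a x).toLinearMap
          (mvfderiv (𝓡 n) u x).toLinearMap * Real.exp (-V x)
        + 2 * (a x * η x * g.innerDual x (mvfderiv (𝓡 n) η x).toLinearMap
            (mvfderiv (𝓡 n) u x).toLinearMap) * Real.exp (-V x)) ∂g.riemVolume :=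
    integral_congr_ae (Eventually.of_forall fun x ↦ by dsimp only; rw [hpt x]; ring)
  have s2 := integral_add i1 i2
  have s3 : ∫ x, 2 * (a x * η x * g.innerDual x (mvfderiv (𝓡 n) η x).toLinearMap
      (mvfderiv (𝓡 n) u x).toLinearMap) * Real.exp (-V x) ∂g.riemVolume =
      2 * ∫ x, a x * η x * g.innerDual x (mvfderiv (𝓡 n) η x).toLinearMap
          (mvfderiv (𝓡 n) u x).toLinearMap * Real.exp (-V x) ∂g.riemVolume := by
    rw [← integral_const_mul]
    exact integral_congr_ae (Eventually.of_forall fun x ↦ by ring)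
  have s0 : ∫ x, a x * η x ^ 2 * (g.dalembertian u x
        - g.innerDual x (mvfderiv (𝓡 n) V x).toLinearMap (mvfderiv (𝓡 n) u x).toLinearMap) *
        Real.exp (-V x) ∂g.riemVolume =
      ∫ x, a x * (η x * η x) * (g.dalembertian u x
        - g.innerDual x (mvfderiv (𝓡 n) V x).toLinearMap (mvfderiv (𝓡 n) u x).toLinearMap) *
        Real.exp (-V x) ∂g.riemVolume :=
    integral_congr_ae (Eventually.of_forall fun x ↦ by ring)
  rw [s0, hG, s1, s2, s3]
  ring

omit [T2Space M] [SecondCountableTopology M] [T3Space M] [MeasurableSpace M] [BorelSpace M]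
  [g.HasLeviCivita] in
/-- **The first-order absorption, pointwise**: `−4 (ρ − c) η g⁻¹(dη, dρ) ≤ η²|∇ρ|² + 4(ρ − c)²|∇η|²`
(`|g⁻¹(dη, dρ)| ≤ |∇η| |∇ρ|` and `2xy ≤ x² + y²`). [folklore] -/
theorem neg_four_mul_cutoff_innerDual_le (hg : g.IsRiemannian) (ρ η : M → ℝ) (c : ℝ) (x : M) :
    -(4 * ((ρ x - c) * η x * g.innerDual x (mvfderiv (𝓡 n) η x).toLinearMap
        (mvfderiv (𝓡 n) ρ x).toLinearMap)) ≤
      η x ^ 2 * g.gradSq ρ x + 4 * ((ρ x - c) ^ 2 * g.gradSq η x) := by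
  have hI := abs_innerDual_le_sqrt_gradSq_mul hg η ρ x
  set I := g.innerDual x (mvfderiv (𝓡 n) η x).toLinearMap (mvfderiv (𝓡 n) ρ x).toLinearMap
  have hη2 : Real.sqrt (g.gradSq η x) ^ 2 = g.gradSq η x := Real.sq_sqrt (g.gradSq_nonneg hg η x)
  have hρ2 : Real.sqrt (g.gradSq ρ x) ^ 2 = g.gradSq ρ x := Real.sq_sqrt (g.gradSq_nonneg hg ρ x)
  have h1 : |4 * ((ρ x - c) * η x * I)| ≤
      2 * (|η x| * Real.sqrt (g.gradSq ρ x)) * (2 * |ρ x - c| * Real.sqrt (g.gradSq η x)) := by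
    rw [abs_mul, abs_mul, abs_mul, abs_of_pos (by norm_num : (0 : ℝ) < 4)]
    have h0 : 0 ≤ |ρ x - c| * |η x| := mul_nonneg (abs_nonneg _) (abs_nonneg _)
    calc 4 * (|ρ x - c| * |η x| * |I|)
        ≤ 4 * (|ρ x - c| * |η x| * (Real.sqrt (g.gradSq η x) * Real.sqrt (g.gradSq ρ x))) :=
          mul_le_mul_of_nonneg_left (mul_le_mul_of_nonneg_left hI h0) (by norm_num)
      _ = 2 * (|η x| * Real.sqrt (g.gradSq ρ x)) * (2 * |ρ x - c| * Real.sqrt (g.gradSq η x)) := by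
          ring
  have h2 : 2 * (|η x| * Real.sqrt (g.gradSq ρ x)) * (2 * |ρ x - c| * Real.sqrt (g.gradSq η x)) ≤
      (|η x| * Real.sqrt (g.gradSq ρ x)) ^ 2 + (2 * |ρ x - c| * Real.sqrt (g.gradSq η x)) ^ 2 :=
    two_mul_le_add_sq _ _
  have h3 : (|η x| * Real.sqrt (g.gradSq ρ x)) ^ 2 + (2 * |ρ x - c| * Real.sqrt (g.gradSq η x)) ^ 2 =
      η x ^ 2 * g.gradSq ρ x + 4 * ((ρ x - c) ^ 2 * g.gradSq η x) := by
    rw [mul_pow, mul_pow, mul_pow, sq_abs, sq_abs, hη2, hρ2]; ring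
  linarith [neg_abs_le (4 * ((ρ x - c) * η x * I)), h1, h2, h3]

omit [T2Space M] [SecondCountableTopology M] [T3Space M] [MeasurableSpace M] [BorelSpace M]
  [g.HasLeviCivita] in
/-- `|∇η|²` vanishes off the topological support of `η`. [folklore] -/
theorem gradSq_eq_zero_of_notMem_tsupport {η : M → ℝ} {x : M} (hx : x ∉ tsupport η) :
    g.gradSq η x = 0 :=
  g.gradSq_eq_zero_of_mvfderiv_eq_zero (mvfderiv_eq_zero_of_notMem_tsupport hx)

end Energy

end Summit.SmoothPoincare4.SmoothPoincare4.Theorems.BakryEmeryComplete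

end
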